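import Mathlib.LinearAlgebra.Lagrange
import Mathlib.Algebra.Polynomial.BigOperators
import HarnessLib

/-!
# The low-degree extension of a function on a subcube `Hᵏ ⊆ Fᵏ` and its restriction to lines

The algebra of the Reed–Muller encoding used by worst-case-to-average-case reductions
(Babai–Fortnow–Nisan–Wigderson 1993, §4; Arora–Barak 2009, §19.4.2 "local decoder for Reed–Muller"
and §8.5.2), for an arbitrary field `F`, a subset `H = v(σ) ⊆ F` given by an injection `v`, and `k`
variables — with UNIVARIATE Lagrange bases (Mathlib's `Lagrange.basis`) throughout, so that no
multivariate polynomial is ever formed: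

* `cubeBasis v c = δ_c` (degree `|H| - 1`, `δ_c(v c') = [c = c']`); `lowDegExt v f` — the extension
  `P(z) = Σ_{a ∈ Hᵏ} f(a) Π_i δ_{aᵢ}(zᵢ)` with `lowDegExt_cube : P(v ∘ a) = f a`;
* `linePoly v f x y` — the restriction `t ↦ P(x + t y)` as a `Polynomial F` (`eval_linePoly`) of
  degree `≤ k (|H| - 1)` (`natDegree_linePoly_le`), whence the **self-correction identity**
  `lowDegExt_eq_sum_nodes`: for distinct nodes `τ₀, …, τ_D`, `D ≥ k(|H|-1)`,
  `P(x) = Σ_a L_a(0) · P(x + τ_a y)` (`Lagrange.eq_interpolate` evaluated at `0`);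
* counting for the corrector over a finite field: `card_filter_line_mem` (`y ↦ x + τ y` is a
  bijection for `τ ≠ 0`) and `card_filter_exists_line_mem` (the directions `y` for which some of
  `D + 1` query points `x + τ_a y` hits a set `B` number `≤ (D+1) #B`).

Related: `Complexity/MultilinearExtension.lean` is the MULTILINEAR (`H = {0,1}`) extension as an
`MvPolynomial` (Aaronson–Wigderson); the subcube version with `|H| > 2` is what keeps the input
length linear in Thm. 19.21 / Thm. 19.27.

## References

* S. Arora, B. Barak, *Computational Complexity: A Modern Approach*, CUP 2009, §8.5.2 (low-degree
  extension), §19.4.2 (Reed–Muller local decoding along lines), Thm. 19.21 [AroraBarakCC2009].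
* L. Babai, L. Fortnow, N. Nisan, A. Wigderson, *BPP has subexponential time simulations unless
  EXPTIME has publishable proofs*, Comput. Complexity 3 (1993) 307–318, §4.
-/

noncomputable section

namespace Literature.Computability.MetaComplexity

open Finset Polynomial

section Ext

variable {F : Type*} [Field F] {k : ℕ} {σ : Type*} [Fintype σ] [DecidableEq σ] (v : σ → F)

/-- The Lagrange indicator `δ_c` of the point `v c` of `H = v(σ) ⊆ F` (`|H| = |σ| = h`): the
polynomial of degree `h - 1` with `δ_c(v c') = [c = c']` (Arora–Barak 2009, §19.3 / Babai–Fortnow–Nisan–Wigderson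
1993, §4: the low-degree extension over a subset `H ⊆ F`). [cite: AroraBarakCC2009, §8.5.2 and §19.4.2] -/
def cubeBasis (c : σ) : F[X] := Lagrange.basis univ v c

/-- `δ_c(v c) = 1`. [folklore] -/
theorem eval_cubeBasis_self (hv : Function.Injective v) (c : σ) : (cubeBasis v c).eval (v c) = 1 :=
  Lagrange.eval_basis_self (hv.injOn.mono (Set.subset_univ _)) (mem_univ c)

/-- `δ_c(v c') = 0` for `c ≠ c'`. [folklore] -/
theorem eval_cubeBasis_of_ne {c c' : σ} (hcc' : c ≠ c') : (cubeBasis v c).eval (v c') = 0 :=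
  Lagrange.eval_basis_of_ne hcc' (mem_univ c')

/-- `deg δ_c = |σ| - 1`. [folklore] -/
theorem natDegree_cubeBasis (hv : Function.Injective v) (c : σ) :
    (cubeBasis v c).natDegree = Fintype.card σ - 1 := by
  rw [cubeBasis, Lagrange.natDegree_basis (hv.injOn.mono (Set.subset_univ _)) (mem_univ c), card_univ]

/-- **The low-degree extension** of `f : Hᵏ → F` to `Fᵏ`:
`P(z) = Σ_{a ∈ Hᵏ} f(a) Π_i δ_{aᵢ}(zᵢ)`, of degree `h - 1` in each variable
(Babai–Fortnow–Nisan–Wigderson 1993; Arora–Barak 2009, §19.4.2, Reed–Muller encoding of a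
function given on a subcube). [cite: AroraBarakCC2009, §19.4.2] -/
def lowDegExt (f : (Fin k → σ) → F) (z : Fin k → F) : F :=
  ∑ a : Fin k → σ, f a * ∏ i, (cubeBasis v (a i)).eval (z i)

/-- **The extension agrees with `f` on the subcube.** [cite: AroraBarakCC2009, §19.4.2] -/
theorem lowDegExt_cube (hv : Function.Injective v) (f : (Fin k → σ) → F) (a : Fin k → σ) :
    lowDegExt v f (fun i => v (a i)) = f a := by
  unfold lowDegExt
  rw [Finset.sum_eq_single a]
  · rw [Finset.prod_eq_one fun i _ => eval_cubeBasis_self v hv (a i), mul_one]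
  · intro b _ hba
    obtain ⟨i, hi⟩ : ∃ i, b i ≠ a i := by
      by_contra hcon
      push Not at hcon
      exact hba (funext hcon)
    rw [Finset.prod_eq_zero (mem_univ i) (eval_cubeBasis_of_ne v hi), mul_zero]
  · intro ha; exact absurd (mem_univ a) ha

/-- **The restriction of the extension to the line `t ↦ x + t y`**, as a univariate polynomial:
`Σ_a f(a) Π_i δ_{aᵢ}(xᵢ + t yᵢ)`. [cite: AroraBarakCC2009, §19.4.2 (local decoding of Reed–Muller codes along lines)] -/
def linePoly (f : (Fin k → σ) → F) (x y : Fin k → F) : F[X] :=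
  ∑ a : Fin k → σ, C (f a) * ∏ i, (cubeBasis v (a i)).comp (C (x i) + X * C (y i))

/-- The line polynomial evaluates to the extension along the line. [folklore] -/
theorem eval_linePoly (f : (Fin k → σ) → F) (x y : Fin k → F) (t : F) :
    (linePoly v f x y).eval t = lowDegExt v f (fun i => x i + t * y i) := by
  unfold linePoly lowDegExt
  rw [eval_finsetSum]
  refine Finset.sum_congr rfl fun a _ => ?_
  rw [eval_mul, eval_C, eval_prod]
  congr 1
  refine Finset.prod_congr rfl fun i _ => ?_
  rw [eval_comp, eval_add, eval_mul, eval_C, eval_C, eval_X]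

/-- **Degree of the line polynomial**: at most `k (h - 1)`, `h = |σ|`. [cite: AroraBarakCC2009, §19.4.2] -/
theorem natDegree_linePoly_le (hv : Function.Injective v) (f : (Fin k → σ) → F) (x y : Fin k → F) :
    (linePoly v f x y).natDegree ≤ k * (Fintype.card σ - 1) := by
  unfold linePoly
  refine (natDegree_sum_le _ _).trans (Finset.sup_le fun a _ => ?_)
  refine (natDegree_C_mul_le _ _).trans ?_
  refine (natDegree_prod_le _ _).trans ?_
  calc ∑ i, ((cubeBasis v (a i)).comp (C (x i) + X * C (y i))).natDegree
      ≤ ∑ _i : Fin k, (Fintype.card σ - 1) := Finset.sum_le_sum fun i _ => by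
        refine (natDegree_comp_le).trans ?_
        rw [natDegree_cubeBasis v hv]
        have : (C (x i) + X * C (y i)).natDegree ≤ 1 := by
          refine (natDegree_add_le _ _).trans (max_le (by simp) ?_)
          exact (natDegree_mul_le).trans (by simp)
        exact (Nat.mul_le_mul_left _ this).trans (by simp)
    _ = k * (Fintype.card σ - 1) := by simp

/-- **Interpolation along a line** (the self-correction identity of Reed–Muller codes:
Arora–Barak 2009, §19.4.2, "the restriction of `P` to a line is a univariate polynomial of degree
`≤ d`, determined by any `d + 1` of its values"): for distinct nodes `τ₀, …, τ_D`, `D ≥ k(h-1)`,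
`P(x) = Σ_a λ_a P(x + τ_a y)` with the Lagrange weights `λ_a = L_a(0)`, `L_a` the Lagrange basis at
the nodes. [cite: AroraBarakCC2009, §19.4.2] -/
theorem lowDegExt_eq_sum_nodes (hv : Function.Injective v) (f : (Fin k → σ) → F) (x y : Fin k → F)
    {D : ℕ} (hD : k * (Fintype.card σ - 1) ≤ D) (τ : Fin (D + 1) → F) (hτ : Function.Injective τ) :
    lowDegExt v f x =
      ∑ a : Fin (D + 1), (Lagrange.basis univ τ a).eval 0 * lowDegExt v f (fun i => x i + τ a * y i) := by
  have hinj : Set.InjOn τ (univ : Finset (Fin (D + 1))) := hτ.injOn.mono (Set.subset_univ _)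
  have hdeg : (linePoly v f x y).degree < #(univ : Finset (Fin (D + 1))) := by
    rw [card_univ, Fintype.card_fin]
    refine lt_of_le_of_lt (degree_le_natDegree) ?_
    exact_mod_cast Nat.lt_succ_of_le ((natDegree_linePoly_le v hv f x y).trans hD)
  have hint := Lagrange.eq_interpolate hinj hdeg
  have h0 := congrArg (fun p : F[X] => p.eval 0) hint
  simp only [eval_linePoly, zero_mul, add_zero] at h0
  rw [show (fun i => x i) = x from rfl] at h0
  rw [h0, Lagrange.interpolate_apply, eval_finsetSum]
  refine Finset.sum_congr rfl fun a _ => ?_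
  rw [eval_mul, eval_C, mul_comm]

end Ext

/-! ### Counting: a random line through `x` avoids a small bad set -/

section Count

variable {F : Type*} [Field F] [Fintype F] [DecidableEq F] {k : ℕ}

/-- Translating and scaling by a unit is a bijection of `Fᵏ`: `#{y | x + τ y ∈ B} = #B` for `τ ≠ 0`.
[folklore] -/
theorem card_filter_line_mem (x : Fin k → F) {τ : F} (hτ : τ ≠ 0) (B : Finset (Fin k → F)) :
    #{y : Fin k → F | (fun i => x i + τ * y i) ∈ B} = #B := by
  refine Finset.card_bij (fun y _ => fun i => x i + τ * y i) (fun y hy => (mem_filter.1 hy).2)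
    (fun y₁ _ y₂ _ h => ?_) (fun z hz => ⟨fun i => τ⁻¹ * (z i - x i), ?_, ?_⟩)
  · funext i
    have := congrFun h i
    have h2 : τ * y₁ i = τ * y₂ i := by simpa using this
    exact mul_left_cancel₀ hτ h2
  · rw [mem_filter]
    refine ⟨mem_univ _, ?_⟩
    convert hz using 1
    funext i
    field_simp
    ring
  · funext i
    field_simp
    ring

/-- **The query points of the self-corrector are individually uniform**, so the seeds `y` for which
SOME query point `x + τ_a y` (over `D + 1` nonzero nodes) falls in a bad set `B` number at most
`(D + 1) · #B` (union bound; Arora–Barak 2009, §19.4.2: "each query is uniformly distributed").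
[cite: AroraBarakCC2009, §19.4.2] -/
theorem card_filter_exists_line_mem (x : Fin k → F) {D : ℕ} (τ : Fin (D + 1) → F) (hτ : ∀ a, τ a ≠ 0)
    (B : Finset (Fin k → F)) :
    #{y : Fin k → F | ∃ a, (fun i => x i + τ a * y i) ∈ B} ≤ (D + 1) * #B := by
  classical
  have hcover : (univ.filter fun y : Fin k → F => ∃ a, (fun i => x i + τ a * y i) ∈ B) =
      univ.biUnion fun a : Fin (D + 1) => univ.filter fun y : Fin k → F => (fun i => x i + τ a * y i) ∈ B := by
    ext y; simp
  rw [hcover]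
  refine card_biUnion_le.trans ?_
  calc ∑ a : Fin (D + 1), #{y : Fin k → F | (fun i => x i + τ a * y i) ∈ B}
      = ∑ _a : Fin (D + 1), #B := Finset.sum_congr rfl fun a _ => card_filter_line_mem x (hτ a) B
    _ = (D + 1) * #B := by simp
  exact le_rfl

end Count

end Literature.Computability.MetaComplexity

end
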